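import Mathlib
import HarnessLib

/-!
# The Kolmogorov-weighted (transport) form of the viscous Katz–Pavlović chain
# (helper file for the crux `SubOnsagerCeiling.ForwardTailCeilingKP`, stmt-NavierStokesRegularity-27057, `--supports`)

Chain format VERBATIM that of `Theorems/SubOnsagerCeilingKPChainPeak.lean` and of the LEAD's chain rungs:
`Ż_k = c₀ (b^{5(k-1)/2} Z_{k-1}² − b^{5k/2} Z_k Z_{k+1}) − ν b^{2k} Z_k`, `Z_{-1} ≡ 0`.  Put `W := b^{5/6}` and
`u_k := W^k Z_k` (Kolmogorov-weighted amplitudes; the `θ`-shell barrier of the registered stubs is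
`u_k ≤ √D · b^{(5/6−θ)k}|x₀|`, and `(θ, D) = (5/6, 1)` is `u_k ≤ |x₀|`).  This file records, as kernel facts, the dictionary
used by the front analysis (memo FRONT-TRANSPORT-leafhand4-g9.md on the item; `Theorems/SubOnsagerCeilingKPChainFirstOvershoot.lean`):

* `kolmogorovForm_hasDerivWithinAt` — in the weighted currency the chain reads
  `u̇_k = c₀ W⁻¹ (W²)^k (u_{k-1}² − u_k u_{k+1}) − ν b^{2k} u_k`: the nonlinearity is SHELL-FREE up to the geometric clock
  `(W²)^k = b^{5k/3}` (so as `b ↓ 1` its smooth part is the transport / Burgers structure of the memo);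
* `kolmogorov_constants_are_equilibria` — every constant `u ≡ U`, i.e. `Z_k = U / W^k`, annihilates the inviscid
  nonlinearity at every shell `k ≥ 1` and EVERY ratio `b` (the K41 state is an exact equilibrium of the inviscid chain);
* `bondFlux_kolmogorovForm` — the bond flux is shell-free in the weighted currency:
  `c₀ b^{5k/2} Z_k² Z_{k+1} = c₀ W⁻¹ · u_k² u_{k+1}`;
* `shellEnergy_kolmogorovForm` — `½ Z_k² = ½ ((W²)^k)⁻¹ u_k²` (the energy weight `b^{-5k/3}` of the memo's `Σ_k b^{-5k/3}u_k²/2`).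

HONEST FRAMING: elementary identities about a MODEL lattice ODE (route SubOnsagerCeiling, rung TL-M2Break); no stub, crux or
summit is proved here and nothing in this file bears on Navier–Stokes regularity.
[cite: Tao2016AveragedNS, §4 (4.13)] [cite: BarbatoMorandinRomito2011, §2 (the chain)]
-/

noncomputable section

-- the sub-problem namespace `NavierStokesRegularity.NavierStokesRegularity` is the tree's layout (D-0017)
set_option linter.dupNamespace false

namespace Summit.NavierStokesRegularity.NavierStokesRegularity.Theorems.KPChainFront

open Set

/-- `(b^{5/6})^3 = b^{5/2}`. [this file] -/
theorem kolmogorovWeight_pow_three {b : ℝ} (hb : 0 < b) :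
    (b ^ ((5 : ℝ) / 6)) ^ 3 = b ^ ((5 : ℝ) / 2) := by
  rw [← Real.rpow_natCast, ← Real.rpow_mul hb.le]
  norm_num

/-- `b^{5k/2} = ((b^{5/6})^3)^k`. [this file] -/
theorem drainWeight_eq_pow {b : ℝ} (hb : 0 < b) (k : ℕ) :
    b ^ ((5 : ℝ) * (k : ℝ) / 2) = ((b ^ ((5 : ℝ) / 6)) ^ 3) ^ k := by
  rw [kolmogorovWeight_pow_three hb, ← Real.rpow_natCast, ← Real.rpow_mul hb.le]
  congr 1; ring

/-- `b^{5((m+1)-1)/2} = ((b^{5/6})^3)^m`. [this file] -/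
theorem feedWeight_eq_pow {b : ℝ} (hb : 0 < b) (m : ℕ) :
    b ^ ((5 : ℝ) * (((m + 1 : ℕ) : ℝ) - 1) / 2) = ((b ^ ((5 : ℝ) / 6)) ^ 3) ^ m := by
  rw [kolmogorovWeight_pow_three hb, ← Real.rpow_natCast, ← Real.rpow_mul hb.le]
  congr 1; push_cast; ring

/-- **The Kolmogorov-weighted form of the chain.**  If `Z` solves the viscous chain on `[0,s]` (LEAD format, `Z_{-1} ≡ 0`),
then `u_k = W^k Z_k`, `W = b^{5/6}`, satisfies `u̇_k = c₀ W⁻¹ (W²)^k (u_{k-1}² − u_k u_{k+1}) − ν b^{2k} u_k` within `[0,s]`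
(for `k = 0` the term `u_{k-1}` is `W^0 Z_{-1} = 0`). [this file] -/
theorem kolmogorovForm_hasDerivWithinAt {b c₀ ν s : ℝ} (hb : 0 < b) {Z : ℤ → ℝ → ℝ}
    (hvan : ∀ t, Z (-1) t = 0)
    (hode : ∀ k : ℕ, ∀ t ∈ Icc 0 s, HasDerivWithinAt (Z k)
      (c₀ * (b ^ ((5 : ℝ) * ((k : ℝ) - 1) / 2) * Z ((k : ℤ) - 1) t ^ 2 -
          b ^ ((5 : ℝ) * (k : ℝ) / 2) * (Z k t * Z ((k : ℤ) + 1) t)) -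
        ν * b ^ ((2 : ℝ) * (k : ℝ)) * Z k t) (Icc 0 s) t)
    (k : ℕ) {t : ℝ} (ht : t ∈ Icc 0 s) :
    HasDerivWithinAt (fun τ => (b ^ ((5 : ℝ) / 6)) ^ k * Z k τ)
      (c₀ * (b ^ ((5 : ℝ) / 6))⁻¹ * ((b ^ ((5 : ℝ) / 6)) ^ 2) ^ k *
          (((b ^ ((5 : ℝ) / 6)) ^ (k - 1) * Z ((k : ℤ) - 1) t) ^ 2 -
            ((b ^ ((5 : ℝ) / 6)) ^ k * Z k t) * ((b ^ ((5 : ℝ) / 6)) ^ (k + 1) * Z ((k : ℤ) + 1) t)) -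
        ν * b ^ ((2 : ℝ) * (k : ℝ)) * ((b ^ ((5 : ℝ) / 6)) ^ k * Z k t)) (Icc 0 s) t := by
  set W : ℝ := b ^ ((5 : ℝ) / 6) with hW
  have hWpos : 0 < W := Real.rpow_pos_of_pos hb _
  have hWne : W ≠ 0 := hWpos.ne'
  have h := (hode k t ht).const_mul (W ^ k)
  refine h.congr_deriv ?_
  rcases Nat.eq_zero_or_pos k with rfl | hk
  · -- the datum shell: both `Z_{-1}` terms vanish
    have hv : Z (((0 : ℕ) : ℤ) - 1) t = 0 := by simpa using hvan t
    rw [hv]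
    have h0 : b ^ ((5 : ℝ) * ((0 : ℕ) : ℝ) / 2) = 1 := by simp
    rw [h0]
    field_simp
    ring
  · obtain ⟨m, rfl⟩ : ∃ m, k = m + 1 := ⟨k - 1, by omega⟩
    rw [feedWeight_eq_pow hb m, drainWeight_eq_pow hb (m + 1)]
    rw [← hW]
    have hkm : m + 1 - 1 = m := by omega
    rw [hkm]
    field_simp
    ring

/-- **K41 constants are equilibria at every ratio.**  For every `U` and every `b > 0` the Kolmogorov family
`Z_k = U / W^k` (`W = b^{5/6}`, i.e. `u ≡ U`) annihilates the inviscid nonlinearity of every shell `k ≥ 1`: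
`c₀ (b^{5(k-1)/2} Z_{k-1}² − b^{5k/2} Z_k Z_{k+1}) = 0`. [this file] -/
theorem kolmogorov_constants_are_equilibria {b : ℝ} (hb : 0 < b) (c₀ U : ℝ) {k : ℕ} (hk : 1 ≤ k) :
    c₀ * (b ^ ((5 : ℝ) * ((k : ℝ) - 1) / 2) * (U / (b ^ ((5 : ℝ) / 6)) ^ (k - 1)) ^ 2 -
        b ^ ((5 : ℝ) * (k : ℝ) / 2) * ((U / (b ^ ((5 : ℝ) / 6)) ^ k) * (U / (b ^ ((5 : ℝ) / 6)) ^ (k + 1)))) = 0 := by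
  set W : ℝ := b ^ ((5 : ℝ) / 6) with hW
  have hWpos : 0 < W := Real.rpow_pos_of_pos hb _
  have hWne : W ≠ 0 := hWpos.ne'
  obtain ⟨m, rfl⟩ : ∃ m, k = m + 1 := ⟨k - 1, by omega⟩
  rw [feedWeight_eq_pow hb m, drainWeight_eq_pow hb (m + 1), ← hW]
  have hkm : m + 1 - 1 = m := by omega
  rw [hkm]
  field_simp
  ring

/-- **The bond flux is shell-free in the weighted currency**: `c₀ b^{5k/2} Z_k² Z_{k+1} = c₀ W⁻¹ (W^k Z_k)² (W^{k+1} Z_{k+1})`,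
`W = b^{5/6}`. [this file] -/
theorem bondFlux_kolmogorovForm {b : ℝ} (hb : 0 < b) (c₀ : ℝ) (Z : ℤ → ℝ → ℝ) (k : ℕ) (t : ℝ) :
    c₀ * b ^ ((5 : ℝ) * (k : ℝ) / 2) * Z k t ^ 2 * Z ((k : ℤ) + 1) t =
      c₀ * (b ^ ((5 : ℝ) / 6))⁻¹ * ((b ^ ((5 : ℝ) / 6)) ^ k * Z k t) ^ 2 *
        ((b ^ ((5 : ℝ) / 6)) ^ (k + 1) * Z ((k : ℤ) + 1) t) := by
  set W : ℝ := b ^ ((5 : ℝ) / 6) with hW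
  have hWpos : 0 < W := Real.rpow_pos_of_pos hb _
  have hWne : W ≠ 0 := hWpos.ne'
  rw [drainWeight_eq_pow hb k, ← hW]
  field_simp
  ring

/-- **Shell energy in the weighted currency**: `½ Z_k² = ½ ((W²)^k)⁻¹ (W^k Z_k)²`, `W = b^{5/6}` — the weight `b^{-5k/3}` of
the conserved energy `Σ_k b^{-5k/3} u_k²/2`. [this file] -/
theorem shellEnergy_kolmogorovForm {b : ℝ} (hb : 0 < b) (Z : ℤ → ℝ → ℝ) (k : ℕ) (t : ℝ) :
    (1 / 2 : ℝ) * Z k t ^ 2 =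
      (1 / 2 : ℝ) * (((b ^ ((5 : ℝ) / 6)) ^ 2) ^ k)⁻¹ * ((b ^ ((5 : ℝ) / 6)) ^ k * Z k t) ^ 2 := by
  have hWpos : 0 < b ^ ((5 : ℝ) / 6) := Real.rpow_pos_of_pos hb _
  have hWne : b ^ ((5 : ℝ) / 6) ≠ 0 := hWpos.ne'
  field_simp
  ring

end Summit.NavierStokesRegularity.NavierStokesRegularity.Theorems.KPChainFront

end
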